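import Literature.NumberTheory.Automorphic.AdelicGLnGlue
import HarnessLib

/-!
# The right modulus of continuity of a level-invariant function along products of one-parameter
# elements (the generic half of the oscillation estimate for Arthur's truncated kernel)

Topic `NumberTheory/Automorphic`; namespace `Literature.NumberTheory.Automorphic`. Proof file:
theorems only (no definition, no named fact, no instance, no `sorry`); imports = tree + Mathlib.

THE POINT (Rogawski (1990), §2.2 p. 13; Arthur (1978), §7; Gelbart (1975), §9.B). The cell bound
for the truncated kernel `k^T` on `U(3)` (★
`Literature.NumberTheory.Automorphic.UnitaryGroup.norm_truncatedKernel_le_card_mul_of_forall_conj`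
of `UnitaryGroupTruncatedKernelCellBound`) asks for a uniform right modulus of continuity
`‖f x − f (x · w)‖ ≤ ε` of the test function `f` over the conjugate `w ∈ g⁻¹ 𝓕 g` of a fundamental
domain `𝓕` of `N(F)` in `N(𝔸_F)`, small high in the cusp. Read on `GL₃(𝔸_E)`, such a `w` is a
product of a FEW archimedean one-parameter elements `exp (tᵢ Xᵢ)` with SMALL parameters `|tᵢ| ≤ ρ`
and directions `Xᵢ` in a fixed compact set, times an element `u` of a finite level under which `f`
is right invariant (the geometry of `Ad(g⁻¹)` on the Heisenberg group supplies this normal form;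
the Lipschitz bound `‖φ (z · exp (tX)) − φ z‖ ≤ L |t|` along one-parameter subgroups is the mean
value theorem for archimedean-smooth compactly supported `φ`, ★
`IsArchSmooth.norm_sub_le_of_lieDeriv_le`). This file is the elementary bookkeeping that turns
these two inputs into `‖φ (z · w) − φ z‖ ≤ k · L · ρ` (telescoping along the product and right
invariance under the level) — stated first for an arbitrary group (§1), then dressed for
`GL_n(𝔸_K)` with the archimedean one-parameter elements `(exp (tX), 1)` (§2).

* §1 `norm_apply_mul_mul_sub_le`, `norm_apply_mul_prod_sub_le_length_mul`,
  `norm_apply_mul_prod_mul_sub_le_of_forall` — telescoping over a list of right factors and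
  absorption of a right-invariance subgroup, for `φ : G → V` (`V` any seminormed group).
* §2 `norm_apply_mul_ofInfinite_expGL_prod_mul_sub_le` (list form),
  `norm_sub_le_of_three_expGL` (three factors, the shape consumed on `U(3)`),
  `norm_sub_le_of_expGL` (one factor).

## References

* J. D. Rogawski, *Automorphic Representations of Unitary Groups in Three Variables*, Ann. of
  Math. Studies 123 (1990), §2.2 (p. 13) [Rogawski1990].
* J. Arthur, *A trace formula for reductive groups I*, Duke Math. J. 45 (1978), §7 (through the two
  expositions above and below).
* S. Gelbart, *Automorphic forms on adele groups*, Ann. of Math. Studies 83 (1975), §9.B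
  [Gelbart1975].
-/

set_option autoImplicit false

noncomputable section

-- `open scoped Classical` is needed to see the Mathlib (normed ring) instances on `mixedSpace K` (note H5 of
-- `AdelicGLnGlue`)
open scoped MatrixGroups Classical
open NumberField NumberField.mixedEmbedding IsDedekindDomain

namespace Literature.NumberTheory.Automorphic

/-! ## §1 Telescoping along right factors, absorbing a right-invariance subgroup -/

section Abstract

variable {G : Type*} [Group G] {V : Type*} [SeminormedAddCommGroup V] (φ : G → V)

/-- **Two right factors**: `‖φ (z·a·b) − φ z‖ ≤ ‖φ ((z·a)·b) − φ (z·a)‖ + ‖φ (z·a) − φ z‖`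
(triangle inequality). [cite: Rogawski1990, §2.2 (p. 13)] -/
theorem norm_apply_mul_mul_sub_le (z a b : G) :
    ‖φ (z * (a * b)) - φ z‖ ≤ ‖φ (z * a * b) - φ (z * a)‖ + ‖φ (z * a) - φ z‖ := by
  rw [← mul_assoc]
  exact norm_sub_le_norm_sub_add_norm_sub _ _ _

/-- **Telescoping along a list of right factors**: if every factor `g ∈ l` moves `φ` by at most
`ε` under right translation, uniformly in the base point, then the product moves `φ` by at most
`(length l) · ε`. [cite: Rogawski1990, §2.2 (p. 13)] -/
theorem norm_apply_mul_prod_sub_le_length_mul (l : List G) {ε : ℝ}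
    (h : ∀ g ∈ l, ∀ z : G, ‖φ (z * g) - φ z‖ ≤ ε) (z : G) :
    ‖φ (z * l.prod) - φ z‖ ≤ l.length * ε := by
  induction l generalizing z with
  | nil => simp
  | cons a l ih =>
    rw [List.prod_cons, List.length_cons, Nat.cast_succ, add_mul, one_mul]
    have ha : ‖φ (z * a) - φ z‖ ≤ ε := h a (by simp) z
    have hl : ‖φ (z * a * l.prod) - φ (z * a)‖ ≤ l.length * ε :=
      ih (fun g hg w => h g (List.mem_cons_of_mem a hg) w) (z * a)
    calc ‖φ (z * (a * l.prod)) - φ z‖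
        ≤ ‖φ (z * a * l.prod) - φ (z * a)‖ + ‖φ (z * a) - φ z‖ := norm_apply_mul_mul_sub_le φ z a _
      _ ≤ l.length * ε + ε := add_le_add hl ha

/-- **Absorbing a right-invariance subgroup**: if `φ` is right invariant under `U` then a right
factor `u ∈ U` after the product costs nothing. [cite: Rogawski1990, §2.2 (p. 13)] -/
theorem norm_apply_mul_prod_mul_sub_le_of_forall {U : Subgroup G} (hU : ∀ u ∈ U, ∀ z : G, φ (z * u) = φ z)
    (l : List G) {ε : ℝ} (h : ∀ g ∈ l, ∀ z : G, ‖φ (z * g) - φ z‖ ≤ ε) {u : G} (hu : u ∈ U)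
    (z : G) : ‖φ (z * (l.prod * u)) - φ z‖ ≤ l.length * ε := by
  rw [← mul_assoc, hU u hu]
  exact norm_apply_mul_prod_sub_le_length_mul φ l h z

/-- **One-parameter factors with small parameters.** For a family of one-parameter maps
`c : ι → ℝ → G` which move `φ` Lipschitz-continuously in the parameter, `‖φ (z · c i t) − φ z‖ ≤ L|t|`
for the directions `i ∈ S`, a product of `k` factors `c iⱼ tⱼ` with `iⱼ ∈ S`, `|tⱼ| ≤ ρ`, followed by
an element of a right-invariance subgroup, moves `φ` by at most `k · (L · ρ)`.
[cite: Rogawski1990, §2.2 (p. 13)] -/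
theorem norm_apply_mul_prod_oneParam_sub_le {ι : Type*} (c : ι → ℝ → G) {S : Set ι} {L : ℝ}
    (hL0 : 0 ≤ L) (hL : ∀ z : G, ∀ i ∈ S, ∀ t : ℝ, ‖φ (z * c i t) - φ z‖ ≤ L * |t|)
    {U : Subgroup G} (hU : ∀ u ∈ U, ∀ z : G, φ (z * u) = φ z) {ρ : ℝ}
    (l : List (ι × ℝ)) (hl : ∀ p ∈ l, p.1 ∈ S ∧ |p.2| ≤ ρ) {u : G} (hu : u ∈ U) (z : G) :
    ‖φ (z * ((l.map fun p => c p.1 p.2).prod * u)) - φ z‖ ≤ l.length * (L * ρ) := by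
  have h := norm_apply_mul_prod_mul_sub_le_of_forall φ hU (l.map fun p => c p.1 p.2)
    (ε := L * ρ) (fun g hg w => ?_) hu z
  · simpa only [List.length_map] using h
  · obtain ⟨p, hp, rfl⟩ := List.mem_map.1 hg
    obtain ⟨hpS, hpρ⟩ := hl p hp
    exact (hL w p.1 hpS p.2).trans (mul_le_mul_of_nonneg_left hpρ hL0)

end Abstract

/-! ## §2 The `GL_n(𝔸_K)` dress: archimedean one-parameter elements `(exp (tX), 1)` -/

section GLn

variable {n : ℕ} {K : Type} [Field K] [NumberField K] {V : Type*} [SeminormedAddCommGroup V]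
  (φ : GL (Fin n) (AdeleRing (𝓞 K) K) → V)

/-- **List form on `GL_n(𝔸_K)`.** If `φ` is right invariant under `U ≤ GL_n(𝔸_K)` and
`‖φ (z · (exp (tX), 1)) − φ z‖ ≤ L|t|` for all `z`, all directions `X ∈ S ⊆ 𝔤𝔩_n(K_∞)` and all `t`,
then for parameters `|tⱼ| ≤ ρ`, directions `Xⱼ ∈ S` and `u ∈ U`:
`‖φ (z · ((∏ⱼ exp (tⱼ Xⱼ), 1) · u)) − φ z‖ ≤ k · (L · ρ)`. [cite: Rogawski1990, §2.2 (p. 13)] -/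
theorem norm_apply_mul_ofInfinite_expGL_prod_mul_sub_le {U : Subgroup (GL (Fin n) (AdeleRing (𝓞 K) K))}
    (hU : ∀ u ∈ U, ∀ z, φ (z * u) = φ z) {S : Set (Matrix (Fin n) (Fin n) (mixedSpace K))} {L : ℝ}
    (hL0 : 0 ≤ L)
    (hL : ∀ z, ∀ X ∈ S, ∀ t : ℝ, ‖φ (z * GLn.ofInfinite n K (expGL (t • X))) - φ z‖ ≤ L * |t|)
    {ρ : ℝ} (l : List (Matrix (Fin n) (Fin n) (mixedSpace K) × ℝ)) (hl : ∀ p ∈ l, p.1 ∈ S ∧ |p.2| ≤ ρ)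
    {u : GL (Fin n) (AdeleRing (𝓞 K) K)} (hu : u ∈ U) (z : GL (Fin n) (AdeleRing (𝓞 K) K)) :
    ‖φ (z * (GLn.ofInfinite n K (l.map fun p => expGL (p.2 • p.1)).prod * u)) - φ z‖
      ≤ l.length * (L * ρ) := by
  have h := norm_apply_mul_prod_oneParam_sub_le φ
    (fun (X : Matrix (Fin n) (Fin n) (mixedSpace K)) (t : ℝ) => GLn.ofInfinite n K (expGL (t • X)))
    hL0 hL hU l hl hu z
  rwa [map_list_prod, List.map_map] at *

/-- **THREE FACTORS** (the shape consumed on `U(3)`, where a conjugate of the Heisenberg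
fundamental domain is a product of three elementary unipotents `1 + a E_{ij} = exp (a E_{ij})`):
`‖φ (z · ((exp (t₁X₁) exp (t₂X₂) exp (t₃X₃), 1) · u)) − φ z‖ ≤ 3 · L · ρ`.
[cite: Rogawski1990, §2.2 (p. 13)] -/
theorem norm_sub_le_of_three_expGL {U : Subgroup (GL (Fin n) (AdeleRing (𝓞 K) K))}
    (hU : ∀ u ∈ U, ∀ z, φ (z * u) = φ z) {S : Set (Matrix (Fin n) (Fin n) (mixedSpace K))} {L : ℝ}
    (hL0 : 0 ≤ L)
    (hL : ∀ z, ∀ X ∈ S, ∀ t : ℝ, ‖φ (z * GLn.ofInfinite n K (expGL (t • X))) - φ z‖ ≤ L * |t|)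
    {ρ t₁ t₂ t₃ : ℝ} (h₁ : |t₁| ≤ ρ) (h₂ : |t₂| ≤ ρ) (h₃ : |t₃| ≤ ρ)
    {X₁ X₂ X₃ : Matrix (Fin n) (Fin n) (mixedSpace K)} (hX₁ : X₁ ∈ S) (hX₂ : X₂ ∈ S) (hX₃ : X₃ ∈ S)
    {u : GL (Fin n) (AdeleRing (𝓞 K) K)} (hu : u ∈ U) (z : GL (Fin n) (AdeleRing (𝓞 K) K)) :
    ‖φ (z * (GLn.ofInfinite n K (expGL (t₁ • X₁) * expGL (t₂ • X₂) * expGL (t₃ • X₃)) * u)) - φ z‖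
      ≤ 3 * L * ρ := by
  have h := norm_apply_mul_ofInfinite_expGL_prod_mul_sub_le φ hU hL0 hL (ρ := ρ)
    [(X₁, t₁), (X₂, t₂), (X₃, t₃)] (fun p hp => ?_) hu z
  · simpa [mul_assoc] using h
  · simp only [List.mem_cons, List.not_mem_nil, or_false] at hp
    rcases hp with rfl | rfl | rfl
    exacts [⟨hX₁, h₁⟩, ⟨hX₂, h₂⟩, ⟨hX₃, h₃⟩]

/-- **ONE FACTOR**: `‖φ (z · ((exp (tX), 1) · u)) − φ z‖ ≤ L · ρ` for `X ∈ S`, `|t| ≤ ρ`, `u ∈ U`.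
[cite: Rogawski1990, §2.2 (p. 13)] -/
theorem norm_sub_le_of_expGL {U : Subgroup (GL (Fin n) (AdeleRing (𝓞 K) K))}
    (hU : ∀ u ∈ U, ∀ z, φ (z * u) = φ z) {S : Set (Matrix (Fin n) (Fin n) (mixedSpace K))} {L : ℝ}
    (hL0 : 0 ≤ L)
    (hL : ∀ z, ∀ X ∈ S, ∀ t : ℝ, ‖φ (z * GLn.ofInfinite n K (expGL (t • X))) - φ z‖ ≤ L * |t|)
    {ρ t : ℝ} (ht : |t| ≤ ρ) {X : Matrix (Fin n) (Fin n) (mixedSpace K)} (hX : X ∈ S)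
    {u : GL (Fin n) (AdeleRing (𝓞 K) K)} (hu : u ∈ U) (z : GL (Fin n) (AdeleRing (𝓞 K) K)) :
    ‖φ (z * (GLn.ofInfinite n K (expGL (t • X)) * u)) - φ z‖ ≤ L * ρ := by
  have h := norm_apply_mul_ofInfinite_expGL_prod_mul_sub_le φ hU hL0 hL (ρ := ρ) [(X, t)]
    (fun p hp => ?_) hu z
  · simpa using h
  · simp only [List.mem_cons, List.not_mem_nil, or_false] at hp
    subst hp
    exact ⟨hX, ht⟩

end GLn

end Literature.NumberTheory.Automorphic

end
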